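import Summits.CriticalPhenomena.PercolationContinuityZ3.Theorems.PercNearOneGluingNoHeavyLowerTailSunflowerLocalLoad
import HarnessLib

/-!
# `NoHeavyLowerTail` (crux stmt-CriticalPhenomena-4575), abstract sunflower cubic: the equal-split LOCAL LOAD INEQUALITY is FALSE
# — `not_triangleFreeLocalLoad : ¬ TriangleFreeLocalLoad` (an 8-vertex bipartite counterexample, evaluated by `native_decide`)

Support file (seat `prim-ineq-prove-1` gen 41; `--supports stmt-CriticalPhenomena-4575`, COMPUTATIONAL: three `native_decide` evaluations
of one 6561-configuration fibre).  Memo: run/shared/lean/prim/prim-ineq-prove-1/LLI-COUNTEREXAMPLE-g41.md (and FINDING-LLI-prove1-g41.md).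

`…SunflowerLocalLoad` (same seat, same day) defined the equal-split load `Bridge.load` of a GOOD configuration, the fibrewise local load
inequality `Bridge.LocalLoad`, proved `LocalLoad ⟹ weighted inequality ⟹ Safe`, and stated `Bridge.TriangleFreeLocalLoad` (LLI on every
fibre of every triangle-free graph core; exact-census support on ≤ 7 vertices).  The 8-vertex census refutes it, and this file proves the
refutation in the kernel:

* the graph `LLICex.G8` on `Fin 8` with edges 01, 06, 17, 27, 37, 47, 57 (a path 6–0–1–7 plus four pendant twins 2,3,4,5 of 7; bipartite,
  hence `CliqueFree 3` via a 2-colouring);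
* its four maximal independent sets `LLICex.Ms = {0,2,3,4,5}, {1,…,6}, {0,7}, {6,7}` with blocks `0,1,2,2`, and the up-sets
  `LLICex.V8 k = {ω | ω ⊄ M for every maximal independent M outside block k}` (`V8_upper`; `V8_cap`: pairwise intersections lie in the
  core, via the finite check `key4` that four points missing the four maximal independent sets span an edge);
* the profile `m ≡ 1` and the GOOD configuration `LLICex.g0` (rows {0,2,3,4,5,6} ↦ slot 0, {1,7} ↦ slot 1, slot 2 empty);
* computable mirrors (`isA`, `inV`, `inW`, `Jset`, `badP`, `goodP`, `agreeP`, `C1`, `goodOverP`, `loadP`) of the fibre predicates of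
  `…SunflowerBipartiteSymmetrisation` / `…SunflowerLocalLoad` with the bridge lemmas `row_mem_edgeCore_iff`, `row_mem_Wof_iff`, `J_eq`,
  `badG_iff`, `goodG_iff`, `agree_iff`, `goodOver_eq`, `load_eq` (definitional unfoldings; fast decision procedures `isAfast`,
  `badP3`, `goodPfast` are proved equivalent and registered as the `Decidable` instances);
* the evaluation: `good_count` (#GOOD = 1356), `badTop_count` (180 rainbow configurations), `frame_sum` (the two non-empty frames of `g0`
  contribute 1 + 7/8), whence `loadP_g0 : loadP g0 = 180/1356 + 15/8` (= 1815/904 > 2 = (K−1)!) and **`not_triangleFreeLocalLoad`**.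

Axioms: propext, Classical.choice, Quot.sound and `Lean.ofReduceBool` (the three `native_decide` counts and two `native_decide` checks of
`g0`; each is a plain enumeration of the 3⁸ slot assignments — `decide` in the kernel is far too slow for them).  Independent exact
confirmation in Python (Fractions): HOME/code-g41/py/exact_lli.py.
-/

namespace Summit.CriticalPhenomena.PercolationContinuityZ3.Theorems.SunflowerPartition

namespace Bridge

namespace LLICex

open Finset

/-- Adjacency table of the 8-vertex counterexample graph (0-indexed): edges 01, 06, 17, 27, 37, 47, 57
(= 12, 17, 28, 38, 48, 58, 68 in the memo's 1-indexed names). -/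
def adjB (u v : Fin 8) : Bool :=
  let e : Fin 8 → Fin 8 → Bool := fun a b =>
    (a = 0 ∧ b = 1) || (a = 0 ∧ b = 6) || (a = 1 ∧ b = 7) || (a = 2 ∧ b = 7) || (a = 3 ∧ b = 7) || (a = 4 ∧ b = 7) || (a = 5 ∧ b = 7)
  e u v || e v u

/-- The counterexample graph `Γ₈`. -/
def G8 : SimpleGraph (Fin 8) where
  Adj u v := adjB u v = true
  symm := ⟨by decide⟩
  loopless := ⟨by decide⟩

/-- Decidability instance (computable). -/
instance : DecidableRel G8.Adj := fun u v => inferInstanceAs (Decidable (adjB u v = true))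

/-- The four maximal independent sets. -/
def Ms : Fin 4 → Finset (Fin 8) := ![{0,2,3,4,5}, {1,2,3,4,5,6}, {0,7}, {6,7}]

/-- Block of each maximal independent set (three petals). -/
def blk : Fin 4 → Fin 3 := ![0, 1, 2, 2]

/-- The up-sets `V k`: sets not contained in any maximal independent set outside block `k`. -/
def V8 (k : Fin 3) : Set (Set (Fin 8)) := {ω | ∀ i : Fin 4, blk i ≠ k → ¬ (ω ⊆ ↑(Ms i))}

/-- Each `V8 k` is an up-set. [this work] -/
theorem V8_upper (k : Fin 3) : IsUpperSet (V8 k) := by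
  intro ω ω' hle hω i hi hsub
  exact hω i hi (Set.Subset.trans hle hsub)

/-- Key finite check: four points missing the four maximal independent sets respectively span an edge. -/
theorem key4 : ∀ x0 x1 x2 x3 : Fin 8, x0 ∉ Ms 0 → x1 ∉ Ms 1 → x2 ∉ Ms 2 → x3 ∉ Ms 3 →
    ∃ u ∈ ({x0, x1, x2, x3} : Finset (Fin 8)), ∃ v ∈ ({x0, x1, x2, x3} : Finset (Fin 8)), G8.Adj u v := by
  decide

/-- Distinct `V8 i`, `V8 j` meet inside the core `edgeCore G8`. [this work] -/
theorem V8_cap (i j : Fin 3) (hij : i ≠ j) : V8 i ∩ V8 j ⊆ SafeCalc.edgeCore G8 := by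
  classical
  rintro ω ⟨hi, hj⟩
  have hall : ∀ t : Fin 4, ¬ (ω ⊆ ↑(Ms t)) := by
    intro t
    by_cases h1 : blk t = i
    · have h2 : blk t ≠ j := by rw [h1]; exact hij
      exact hj t h2
    · exact hi t h1
  have pick : ∀ t : Fin 4, ∃ x ∈ ω, x ∉ Ms t := by
    intro t
    by_contra h
    push Not at h
    exact hall t fun x hx => by simpa using h x hx
  obtain ⟨x0, h0, n0⟩ := pick 0
  obtain ⟨x1, h1, n1⟩ := pick 1
  obtain ⟨x2, h2, n2⟩ := pick 2
  obtain ⟨x3, h3, n3⟩ := pick 3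
  obtain ⟨u, hu, v, hv, huv⟩ := key4 x0 x1 x2 x3 n0 n1 n2 n3
  have memω : ∀ w ∈ ({x0, x1, x2, x3} : Finset (Fin 8)), w ∈ ω := by
    intro w hw
    simp only [Finset.mem_insert, Finset.mem_singleton] at hw
    rcases hw with rfl | rfl | rfl | rfl <;> assumption
  exact ⟨u, v, huv, memω u hu, memω v hv⟩

/-- `Γ₈` is bipartite, hence triangle-free. -/
theorem G8_cliqueFree : G8.CliqueFree 3 := by
  have hc : G8.Colorable 2 :=
    ⟨SimpleGraph.Coloring.mk (fun v : Fin 8 => (if v ∈ ({0, 7} : Finset (Fin 8)) then (0 : Fin 2) else 1))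
      (by decide)⟩
  exact hc.cliqueFree (by norm_num)

end LLICex

end Bridge

end Summit.CriticalPhenomena.PercolationContinuityZ3.Theorems.SunflowerPartition

namespace Summit.CriticalPhenomena.PercolationContinuityZ3.Theorems.SunflowerPartition

namespace Bridge

namespace LLICex

open Finset

/-! ## Step 2: computable mirrors of the fibre predicates -/

/-- Slot-set assignments (configurations) on 8 vertices with 3 slots. -/
abbrev Conf := Fin 8 → Finset (Fin 3)

/-- slot `k` of `S` is an A-slot (its row contains an edge). -/
def isA (S : Conf) (k : Fin 3) : Prop := ∃ u v : Fin 8, G8.Adj u v ∧ k ∈ S u ∧ k ∈ S v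

/-- The edge list of `Γ₈` (for fast evaluation). -/
def edges8 : List (Fin 8 × Fin 8) := [(0,1), (0,6), (1,7), (2,7), (3,7), (4,7), (5,7)]

/-- Adjacency = membership in the edge list. [this work] -/
theorem adj_iff_edges (u v : Fin 8) : G8.Adj u v ↔ ((u, v) ∈ edges8 ∨ (v, u) ∈ edges8) := by
  revert u v; decide

/-- Fast form of `isA`: some listed edge lies in the row. -/
def isAfast (S : Conf) (k : Fin 3) : Prop := ∃ e ∈ edges8, k ∈ S e.1 ∧ k ∈ S e.2

/-- Decidability instance (computable). -/
instance (S : Conf) (k : Fin 3) : Decidable (isAfast S k) := by unfold isAfast; infer_instance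

/-- `isA` agrees with its fast form. [this work] -/
theorem isA_iff_fast (S : Conf) (k : Fin 3) : isA S k ↔ isAfast S k := by
  constructor
  · rintro ⟨u, v, huv, hu, hv⟩
    rcases (adj_iff_edges u v).1 huv with h | h
    · exact ⟨(u, v), h, hu, hv⟩
    · exact ⟨(v, u), h, hv, hu⟩
  · rintro ⟨e, he, h1, h2⟩
    exact ⟨e.1, e.2, (adj_iff_edges e.1 e.2).2 (Or.inl he), h1, h2⟩

/-- Decidability instance (computable). -/
instance (S : Conf) (k : Fin 3) : Decidable (isA S k) := decidable_of_iff (isAfast S k) (isA_iff_fast S k).symm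

/-- row `k` of `S` lies in `V8 j`. -/
def inV (S : Conf) (k : Fin 3) (j : Fin 3) : Prop := ∀ i : Fin 4, blk i ≠ j → ¬ (∀ x : Fin 8, k ∈ S x → x ∈ Ms i)

/-- Decidability instance (computable). -/
instance (S : Conf) (k j : Fin 3) : Decidable (inV S k j) := by unfold inV; infer_instance

/-- row `k` of `S` lies in the petal `Wof G8 V8 j`. -/
def inW (S : Conf) (k j : Fin 3) : Prop := inV S k j ∧ ¬ isA S k

/-- Decidability instance (computable). -/
instance (S : Conf) (k j : Fin 3) : Decidable (inW S k j) := by unfold inW; infer_instance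

/-- the non-A slots. -/
def Jset (S : Conf) : Finset (Fin 3) := univ.filter fun k => ¬ isA S k

/-- Computable transcription of `BadG (edgeCore G8) (Wof G8 V8)`. -/
def badP (S : Conf) : Prop :=
  2 ≤ (Jset S).card ∧ ∃ f : Fin 3 → Fin 3, (∀ a ∈ Jset S, ∀ b ∈ Jset S, f a = f b → a = b) ∧ ∀ k ∈ Jset S, inW S k (f k)

/-- The same with the label function spelled out by its three values (fast to decide: no function enumeration). -/
def badP3 (S : Conf) : Prop :=
  2 ≤ (Jset S).card ∧ ∃ a b c : Fin 3, (∀ x ∈ Jset S, ∀ y ∈ Jset S, (![a, b, c] : Fin 3 → Fin 3) x = ![a, b, c] y → x = y) ∧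
    ∀ k ∈ Jset S, inW S k ((![a, b, c] : Fin 3 → Fin 3) k)

/-- Decidability instance (computable). -/
instance (S : Conf) : Decidable (badP3 S) := by unfold badP3; infer_instance

/-- `badP` agrees with its fast form. [this work] -/
theorem badP_iff_badP3 (S : Conf) : badP S ↔ badP3 S := by
  unfold badP badP3
  refine and_congr Iff.rfl ⟨?_, ?_⟩
  · rintro ⟨f, hf⟩
    refine ⟨f 0, f 1, f 2, ?_⟩
    have e : (![f 0, f 1, f 2] : Fin 3 → Fin 3) = f := by ext i; fin_cases i <;> rfl
    rw [e]; exact hf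
  · rintro ⟨a, b, c, h⟩
    exact ⟨_, h⟩

/-- Decidability instance (computable). -/
instance (S : Conf) : Decidable (badP S) := decidable_of_iff (badP3 S) (badP_iff_badP3 S).symm

/-- Computable transcription of `GoodG (edgeCore G8) (Wof G8 V8)`. -/
def goodP (S : Conf) : Prop := ∃ k : Fin 3, Jset S = {k} ∧ ∀ j : Fin 3, ¬ inW S k j

/-- Fast form of `goodP` (no `Finset` equality test). -/
def goodPfast (S : Conf) : Prop := ∃ k : Fin 3, (¬ isA S k ∧ ∀ k' : Fin 3, k' ≠ k → isA S k') ∧ ∀ j : Fin 3, ¬ inW S k j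

/-- Decidability instance (computable). -/
instance (S : Conf) : Decidable (goodPfast S) := by unfold goodPfast; infer_instance

/-- `goodP` agrees with its fast form. [this work] -/
theorem goodP_iff_fast (S : Conf) : goodP S ↔ goodPfast S := by
  unfold goodP goodPfast
  refine exists_congr fun k => and_congr ?_ Iff.rfl
  constructor
  · intro h
    have hk : ∀ k', k' ∈ Jset S ↔ k' = k := fun k' => by rw [h, Finset.mem_singleton]
    refine ⟨?_, fun k' hk' => ?_⟩
    · have := (hk k).2 rfl; simpa [Jset] using this
    · by_contra hA; exact hk' ((hk k').1 (by simpa [Jset] using hA))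
  · rintro ⟨h1, h2⟩
    ext k'
    simp only [Jset, Finset.mem_filter, Finset.mem_univ, true_and, Finset.mem_singleton]
    constructor
    · intro h; by_contra hne; exact h (h2 k' hne)
    · rintro rfl; exact h1

/-- Decidability instance (computable). -/
instance (S : Conf) : Decidable (goodP S) := decidable_of_iff (goodPfast S) (goodP_iff_fast S).symm

/-- Computable transcription of `Agree (edgeCore G8)`. -/
def agreeP (c g : Conf) : Prop := ∀ k : Fin 3, k ∉ Jset c → ∀ x : Fin 8, (k ∈ g x ↔ k ∈ c x)

/-- Decidability instance (computable). -/
instance (c g : Conf) : Decidable (agreeP c g) := by unfold agreeP; infer_instance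

/-- the profile `m ≡ 1`. -/
def m1 : Fin 8 → ℕ := fun _ => 1

/-- the fibre (computable copy of `TypeModel.Model.confs m1`). -/
def C1 : Finset Conf := Fintype.piFinset fun x => (univ : Finset (Fin 3)).powersetCard (m1 x)

/-- The tree's (noncomputable-marked) fibre is our computable `C1`. [this work] -/
theorem confs_eq : TypeModel.Model.confs (K := 3) m1 = C1 := by
  unfold TypeModel.Model.confs C1; rfl

/-- Computable copy of `goodOver`. -/
def goodOverP (c : Conf) : Finset Conf := C1.filter fun g => goodP g ∧ agreeP c g

/-- Computable copy of `load`. -/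
def loadP (g : Conf) : ℚ :=
  ∑ c ∈ C1.filter (fun c => badP c ∧ agreeP c g), ((3 - (Jset c).card).factorial : ℚ) / ((goodOverP c).card : ℚ)

/-- the overloaded GOOD configuration: rows `{0,2,3,4,5,6} ↦ slot 0`, `{1,7} ↦ slot 1`, slot 2 empty. -/
def g0 : Conf := fun x => if x = 1 ∨ x = 7 then {1} else {0}

/-! ## Step 3: bridge lemmas -/

/-- Bridge: A-status of a slot = its row contains an edge. [this work] -/
theorem row_mem_edgeCore_iff (S : Conf) (k : Fin 3) : row S k ∈ SafeCalc.edgeCore G8 ↔ isA S k := by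
  simp [row, SafeCalc.edgeCore, isA]

/-- Bridge: membership in `V8 j`. [this work] -/
theorem row_mem_V8_iff (S : Conf) (k j : Fin 3) : row S k ∈ V8 j ↔ inV S k j := by
  simp [row, V8, inV, Set.subset_def]

/-- Bridge: petal membership. [this work] -/
theorem row_mem_Wof_iff (S : Conf) (k j : Fin 3) : row S k ∈ Wof G8 V8 j ↔ inW S k j := by
  simp [Wof, inW, row_mem_V8_iff, row_mem_edgeCore_iff]

/-- Bridge: the non-A slots. [this work] -/
theorem J_eq (S : Conf) : J (SafeCalc.edgeCore G8) S = Jset S := by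
  ext k
  simp [J, Jset, row_mem_edgeCore_iff]

/-- Bridge: BAD. [this work] -/
theorem badG_iff (S : Conf) : BadG (SafeCalc.edgeCore G8) (Wof G8 V8) S ↔ badP S := by
  simp only [BadG, badP, J_eq, Set.InjOn, Finset.mem_coe, row_mem_Wof_iff]

/-- Bridge: GOOD. [this work] -/
theorem goodG_iff (S : Conf) : GoodG (SafeCalc.edgeCore G8) (Wof G8 V8) S ↔ goodP S := by
  simp only [GoodG, goodP, J_eq, row_mem_Wof_iff]

/-- Bridge: frame agreement. [this work] -/
theorem agree_iff (c g : Conf) : Agree (SafeCalc.edgeCore G8) c g ↔ agreeP c g := by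
  simp only [Agree, agreeP, J_eq, row, Set.ext_iff, Set.mem_setOf_eq]

/-- Bridge: GOOD neighbours. [this work] -/
theorem goodOver_eq (c : Conf) : goodOver (SafeCalc.edgeCore G8) (Wof G8 V8) m1 c = goodOverP c := by
  ext g
  simp only [goodOver, goodOverP, confs_eq, Finset.mem_filter, goodG_iff, agree_iff]

/-- Bridge: the equal-split load. [this work] -/
theorem load_eq (g : Conf) : load (SafeCalc.edgeCore G8) (Wof G8 V8) m1 g = loadP g := by
  classical
  unfold load loadP
  refine Finset.sum_congr ?_ fun c _ => ?_
  · ext c; simp only [confs_eq, Finset.mem_filter, badG_iff, agree_iff]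
  · rw [J_eq, goodOver_eq]

end LLICex

end Bridge

end Summit.CriticalPhenomena.PercolationContinuityZ3.Theorems.SunflowerPartition

namespace Summit.CriticalPhenomena.PercolationContinuityZ3.Theorems.SunflowerPartition

namespace Bridge

namespace LLICex

open Finset

/-! ## Step 4: the computation (three `native_decide` evaluations of the 6561-configuration fibre) and the refutation -/

/-- The summand of the equal-split load. -/
def term (c : Conf) : ℚ := ((3 - (Jset c).card).factorial : ℚ) / ((goodOverP c).card : ℚ)

/-- `loadP` as a sum of `term`s. [this work] -/
theorem loadP_eq_sum (g : Conf) : loadP g = ∑ c ∈ C1.filter (fun c => badP c ∧ agreeP c g), term c := rfl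

/-- For a configuration all of whose slots are non-A, every configuration agrees with it on its (empty) frame. -/
theorem agreeP_of_univ {c : Conf} (hc : Jset c = univ) (g : Conf) : agreeP c g := by
  intro k hk; rw [hc] at hk; exact absurd (Finset.mem_univ k) hk

/-- A rainbow (all-non-A) configuration has every GOOD configuration as a neighbour. [this work] -/
theorem goodOverP_of_univ {c : Conf} (hc : Jset c = univ) : goodOverP c = C1.filter goodP := by
  ext g
  simp only [goodOverP, Finset.mem_filter, agreeP_of_univ hc g, and_true]

/-- The summand of a rainbow configuration is `1/#GOOD`. [this work] -/
theorem term_of_univ {c : Conf} (hc : Jset c = univ) : term c = 1 / ((C1.filter goodP).card : ℚ) := by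
  simp [term, goodOverP_of_univ hc, hc]

/-- #GOOD of the fibre = 1356. [computational, this work] -/
theorem good_count : (C1.filter goodP).card = 1356 := by
  native_decide

/-- 180 rainbow configurations. [computational, this work] -/
theorem badTop_count : ((C1.filter fun c => badP c ∧ agreeP c g0).filter fun c => Jset c = univ).card = 180 := by
  native_decide

/-- The two non-empty frames of `g0` contribute `1 + 7/8`. [computational, this work] -/
theorem frame_sum :
    (∑ c ∈ (C1.filter fun c => badP c ∧ agreeP c g0).filter (fun c => ¬ Jset c = univ), term c) = 15 / 8 := by
  native_decide

/-- `g0` lies in the fibre. [computational, this work] -/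
theorem g0_mem : g0 ∈ C1 := by
  native_decide

/-- `g0` is GOOD. [computational, this work] -/
theorem g0_good : goodP g0 := by
  native_decide

/-- The equal-split load of `g0` is `180/1356 + 15/8 = 1815/904 > 2 = (K−1)!`. [computational, this work] -/
theorem loadP_g0 : loadP g0 = 180 * (1 / 1356) + 15 / 8 := by
  have hU : (∑ c ∈ (C1.filter fun c => badP c ∧ agreeP c g0).filter (fun c => Jset c = univ), term c) =
      180 * (1 / 1356) := by
    rw [Finset.sum_congr rfl (fun c hc => term_of_univ (Finset.mem_filter.1 hc).2), Finset.sum_const, badTop_count,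
      good_count, nsmul_eq_mul]
    norm_num
  rw [loadP_eq_sum, ← Finset.sum_filter_add_sum_filter_not _ (fun c => Jset c = univ), hU, frame_sum]

/-- The load of `g0` exceeds `(K−1)! = 2`. [this work] -/
theorem loadP_g0_gt : ¬ (loadP g0 ≤ ((3 - 1).factorial : ℚ)) := by
  rw [loadP_g0]; norm_num

end LLICex

/-- **The local load inequality is FALSE for triangle-free (even bipartite) graph cores.**  Counterexample: the 8-vertex graph
`LLICex.G8` (edges 01,06,17,27,37,47,57), `K = 3`, the family `LLICex.V8` (petal blocks {0,2,3,4,5} | {1,…,6} | {0,7},{6,7} of the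
maximal independent sets), profile `m ≡ 1`, GOOD configuration `LLICex.g0`: its equal-split load is `1815/904 > 2`.
[computational (one `native_decide` evaluating the 6561-configuration fibre), this work] -/
theorem not_triangleFreeLocalLoad : ¬ TriangleFreeLocalLoad := by
  intro h
  obtain ⟨-, h2⟩ := h 8 LLICex.G8 LLICex.G8_cliqueFree 3 LLICex.V8 LLICex.V8_upper LLICex.V8_cap LLICex.m1
  have hg : LLICex.g0 ∈ TypeModel.Model.confs (K := 3) LLICex.m1 := by
    rw [LLICex.confs_eq]; exact LLICex.g0_mem
  have hgood : GoodG (SafeCalc.edgeCore LLICex.G8) (Wof LLICex.G8 LLICex.V8) LLICex.g0 :=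
    (LLICex.goodG_iff LLICex.g0).2 LLICex.g0_good
  have hle := h2 LLICex.g0 hg hgood
  rw [LLICex.load_eq] at hle
  exact LLICex.loadP_g0_gt hle

end Bridge

end Summit.CriticalPhenomena.PercolationContinuityZ3.Theorems.SunflowerPartition
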